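import Literature.AlgebraicTopology.Homotopy.MappingTelescopeSlide
import HarnessLib

/-!
# Homotopic self-maps have homotopy equivalent mapping telescopes

Topic `Literature/AlgebraicTopology/Homotopy` (sub-namespace `Telescope`), continuing
`MappingTelescope.lean` / `MappingTelescopeSlide.lean`. Hatcher, *Algebraic Topology* (2002),
Appendix, proof of Prop. A.11, fact (1) (p. 528): "`T(f₁, f₂, …) ≃ T(g₁, g₂, …)` if `fᵢ ≃ gᵢ` for
each `i`." We prove it for the telescopes of two self-maps `f ≃ f'` of a compact subset `P` of a
normed space (the homotopy staying in `P`), with explicit maps: on the `k`-th cylinder,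
`Φ (x, k + s) = (x, k + 2s)` for `s ≤ ½` and `= (H(x, 2s - 1), k + 1)` for `s ≥ ½`, where `H` runs
from `f'` to `f`; the inverse `Ψ` uses `H` backwards, and `Ψ Φ ≃ 𝟙` by first contracting the
back-and-forth excursion along `H` and then undoing the reparametrisation.

* `Telescope.HomotopyData P f f'`: a homotopy `H` in `P` with `H(·, 0) = f'`, `H(·, 1) = f`;
  `HomotopyData.reverse`;
* `Telescope.hmapMap … D : C(space f P, space f' P)`: the induced map of telescopes;
* `Telescope.hmapMap_reverse_comp_homotopic`: `Ψ ∘ Φ ≃ 𝟙`;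
* `Telescope.homotopyEquivOfHomotopy … D : space f P ≃ₕ space f' P`.

No `sorry`; [folklore] packaging of Hatcher's "elementary fact" (1).

## References

* A. Hatcher, *Algebraic Topology*, CUP (2002), Appendix, proof of Prop. A.11, fact (1)
  (p. 528); Prop. 0.18 (the underlying homotopy extension argument). [HatcherAT2002]
-/

noncomputable section

open Set Function Topology Filter unitInterval

namespace Literature.AlgebraicTopology.Homotopy

namespace Telescope

/-! ### A gluing lemma for definitions by cases on a real parameter -/

/-- Continuity on `S` of `a ↦ if σ a ≤ c then F a else G a` from continuity of the branches on
the two closed halves and their agreement on the interface `σ = c`. [folklore] -/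
theorem continuousOn_if_le {A Z : Type*} [TopologicalSpace A] [TopologicalSpace Z] {S : Set A}
    {w : A → ℝ} (hw : Continuous w) (c : ℝ) {F G : A → Z}
    (hF : ContinuousOn F (S ∩ {a | w a ≤ c})) (hG : ContinuousOn G (S ∩ {a | c ≤ w a}))
    (hFG : ∀ a ∈ S, w a = c → F a = G a) :
    ContinuousOn (fun a => if w a ≤ c then F a else G a) S := by
  refine ContinuousOn.if ?_ ?_ ?_
  · rintro a ⟨ha, hfr⟩
    exact hFG a ha (frontier_le_subset_eq hw continuous_const hfr)
  · refine hF.mono (inter_subset_inter_right _ ?_)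
    exact (isClosed_le hw continuous_const).closure_subset
  · refine hG.mono (inter_subset_inter_right _ ?_)
    have h1 : {a : A | ¬w a ≤ c} = {a | c < w a} := by
      ext a
      simp [not_le]
    rw [h1]
    exact closure_minimal (fun a (ha : c < w a) => (le_of_lt ha : c ≤ w a))
      (isClosed_le continuous_const hw)

variable {E : Type*} [NormedAddCommGroup E] {P : Set E} {f f' : E → E}

/-! ### Homotopies between self-maps of `P` -/

variable (P f f') in
/-- **A homotopy in `P` from `f'` to `f`**: `H : E → ℝ → E`, continuous on `P × [0, 1]`, valued
in `P` there, with `H(·, 0) = f'` and `H(·, 1) = f`. [folklore] -/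
structure HomotopyData where
  /-- the homotopy, `H x t` -/
  H : E → ℝ → E
  continuousOn_H : ContinuousOn (fun p : E × ℝ => H p.1 p.2) (P ×ˢ Icc 0 1)
  H_mem : ∀ x ∈ P, ∀ t ∈ Icc (0 : ℝ) 1, H x t ∈ P
  H_zero : ∀ x, H x 0 = f' x
  H_one : ∀ x, H x 1 = f x

namespace HomotopyData

/-- The reversed homotopy, from `f` to `f'`. [folklore] -/
def reverse (D : HomotopyData P f f') : HomotopyData P f' f where
  H x t := D.H x (1 - t)
  continuousOn_H := by
    have hg : Continuous fun p : E × ℝ => (p.1, 1 - p.2) := by fun_prop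
    exact D.continuousOn_H.comp hg.continuousOn fun p hp =>
      ⟨hp.1, by constructor <;> linarith [hp.2.1, hp.2.2]⟩
  H_mem x hx t ht := D.H_mem x hx (1 - t) ⟨by linarith [ht.2], by linarith [ht.1]⟩
  H_zero x := by simp [D.H_one]
  H_one x := by simp [D.H_zero]

/-- The reversed homotopy, unfolded. [folklore] -/
@[simp]
theorem reverse_H (D : HomotopyData P f f') (x : E) (t : ℝ) : D.reverse.H x t = D.H x (1 - t) :=
  rfl

/-- `H` composed with maps into `P × [0, 1]` is continuous. [folklore] -/
theorem continuousOn_comp {A : Type*} [TopologicalSpace A] (D : HomotopyData P f f')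
    {S : Set A} {φ : A → E} {ψ : A → ℝ} (hφ : ContinuousOn φ S) (hψ : ContinuousOn ψ S)
    (h : ∀ a ∈ S, φ a ∈ P ∧ ψ a ∈ Icc (0 : ℝ) 1) :
    ContinuousOn (fun a => D.H (φ a) (ψ a)) S :=
  D.continuousOn_H.comp (hφ.prodMk hψ) fun a ha => ⟨(h a ha).1, (h a ha).2⟩

/-- `f'` maps `P` into `P` (it is `H(·, 0)`). [folklore] -/
theorem mapsTo_right (D : HomotopyData P f f') : MapsTo f' P P := fun x hx => by
  rw [← D.H_zero x]
  exact D.H_mem x hx 0 ⟨le_rfl, zero_le_one⟩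

/-- `f` maps `P` into `P` (it is `H(·, 1)`). [folklore] -/
theorem mapsTo_left (D : HomotopyData P f f') : MapsTo f P P := fun x hx => by
  rw [← D.H_one x]
  exact D.H_mem x hx 1 ⟨zero_le_one, le_rfl⟩

end HomotopyData

variable [NormedSpace ℝ E]

/-! ### The map of telescopes induced by a homotopy -/

/-- Levelwise data of the induced map `T(f) → T(f')`: reparametrise the first half of the
cylinder over the whole cylinder, and run the homotopy `H` (from `f'` to `f`) on the second
half, at the bottom of the next cylinder. [folklore] -/
def hmapData (f' : E → E) (H : E → ℝ → E) (k : ℕ) (x : E) (s : ℝ) : E × E × ℝ :=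
  if s ≤ 1 / 2 then emb f' k x (2 * s) else emb f' (k + 1) (H x (2 * s - 1)) 0

/-- The induced map of telescopes as a function on the ambient space. [folklore] -/
def hmap (f' : E → E) (H : E → ℝ → E) : E × E × ℝ → E × E × ℝ := lift (hmapData f' H)

/-- Compatibility of the data with the identification of the source telescope. [folklore] -/
theorem hmapData_compat (D : HomotopyData P f f') (k : ℕ) (x : E) :
    hmapData f' D.H k x 1 = hmapData f' D.H (k + 1) (f x) 0 := by
  unfold hmapData
  rw [if_neg (by norm_num), if_pos (by norm_num)]
  norm_num [D.H_one]

/-- The induced map on telescope points. [folklore] -/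
theorem hmap_emb (D : HomotopyData P f f') (k : ℕ) {x : E} (hx : x ∈ P) {s : ℝ}
    (hs : s ∈ Icc (0 : ℝ) 1) : hmap f' D.H (emb f k x s) = hmapData f' D.H k x s :=
  lift_emb (P := P) (fun k x _ => hmapData_compat D k x) k hx hs

/-- The induced map sends the source telescope into the target telescope. [folklore] -/
theorem hmap_mapsTo (D : HomotopyData P f f') :
    MapsTo (hmap f' D.H) (space f P) (space f' P) := by
  intro p hp
  obtain ⟨k, x, s, hx, hs, rfl⟩ := exists_rep D.mapsTo_left hp
  rw [hmap_emb D k hx (Ico_subset_Icc_self hs), hmapData]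
  split_ifs with h
  · exact emb_mem_space k hx ⟨by linarith [hs.1], by linarith⟩
  · exact emb_mem_space (k + 1) (D.H_mem x hx _ ⟨by linarith, by linarith [hs.2]⟩)
      ⟨le_rfl, zero_le_one⟩

/-- The levelwise data are continuous on `P × [0, 1]`. [folklore] -/
theorem continuousOn_hmapData (hf' : ContinuousOn f' P) (D : HomotopyData P f f') (k : ℕ) :
    ContinuousOn (fun p : E × ℝ => hmapData f' D.H k p.1 p.2) (P ×ˢ Icc 0 1) := by
  refine continuousOn_if_le continuous_snd (1 / 2) ?_ ?_ ?_
  · exact (continuousOn_emb hf' k).comp (continuousOn_fst.prodMk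
      (continuousOn_const.mul continuousOn_snd)) fun p hp => ⟨hp.1.1, mem_univ _⟩
  · refine (continuousOn_emb hf' (k + 1)).comp (ContinuousOn.prodMk ?_ continuousOn_const)
      fun p hp => ⟨D.H_mem _ hp.1.1 _ ⟨?_, ?_⟩, mem_univ _⟩
    · exact D.continuousOn_comp continuousOn_fst
        ((continuousOn_const.mul continuousOn_snd).sub continuousOn_const)
        fun p hp => ⟨hp.1.1, by have h : 1 / 2 ≤ p.2 := hp.2; linarith,
          by linarith [hp.1.2.2]⟩
    · have h : 1 / 2 ≤ p.2 := hp.2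
      linarith
    · linarith [hp.1.2.2]
  · rintro ⟨x, s⟩ - (h : s = 1 / 2)
    subst h
    norm_num [D.H_zero, emb_one]

/-- The induced map is continuous on the source telescope. [folklore] -/
theorem continuousOn_hmap (hP : IsCompact P) (hf : ContinuousOn f P) (hf' : ContinuousOn f' P)
    (D : HomotopyData P f f') : ContinuousOn (hmap f' D.H) (space f P) :=
  continuousOn_of_comp_emb hP hf fun k =>
    (continuousOn_hmapData hf' D k).congr fun _ hp => hmap_emb D k hp.1 hp.2

/-- **The map of telescopes induced by a homotopy** `H : f' ≃ f`, `Φ : T(f) → T(f')`.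
[folklore] -/
def hmapMap (hP : IsCompact P) (hf : ContinuousOn f P) (hf' : ContinuousOn f' P)
    (D : HomotopyData P f f') : C(space f P, space f' P) :=
  mapOfAmbient (hmap f' D.H) (continuousOn_hmap hP hf hf' D) (hmap_mapsTo D)

/-- The induced map does not depend on reversing the homotopy twice. [folklore] -/
theorem hmapMap_reverse_reverse (hP : IsCompact P) (hf : ContinuousOn f P)
    (hf' : ContinuousOn f' P) (D : HomotopyData P f f') :
    hmapMap hP hf hf' D.reverse.reverse = hmapMap hP hf hf' D := by
  have hH : D.reverse.reverse.H = D.H := by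
    funext x t
    simp
  refine ContinuousMap.ext fun p => Subtype.ext ?_
  show hmap f' D.reverse.reverse.H p = hmap f' D.H p
  rw [hH]

/-! ### The composite `Ψ Φ` -/

/-- The back-and-forth time profile of `Ψ Φ` on `[¼, 1]`: `1 → 0` on `[¼, ½]`, `0 → 1` on
`[½, 1]`. [folklore] -/
def vee (s : ℝ) : ℝ := if s ≤ 1 / 2 then 2 - 4 * s else 2 * s - 1

/-- `vee` is continuous. [folklore] -/
theorem continuous_vee : Continuous vee :=
  Continuous.if_le (by fun_prop) (by fun_prop) continuous_id continuous_const
    fun s hs => by rw [hs]; norm_num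

/-- `vee` takes values in `[0, 1]` on `[¼, 1]`. [folklore] -/
theorem vee_mem {s : ℝ} (hs : s ∈ Icc (1 / 4 : ℝ) 1) : vee s ∈ Icc (0 : ℝ) 1 := by
  unfold vee
  split_ifs with h <;> constructor <;> linarith [hs.1, hs.2]

/-- Levelwise data of the homotopy contracting the excursion of `Ψ Φ`: time `u ∈ [0, 1]`,
`(x, k + s) ↦ (x, k + 4s)` for `s ≤ ¼`, and `(H(x, max (vee s) u), k + 1)` beyond; at `u = 0`
this is `Ψ Φ`, at `u = 1` it is `(x, k + min (4s) 1)`. [folklore] -/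
def compData (f : E → E) (H : E → ℝ → E) (u : ℝ) (k : ℕ) (x : E) (s : ℝ) : E × E × ℝ :=
  if s ≤ 1 / 4 then emb f k x (4 * s) else emb f (k + 1) (H x (max (vee s) u)) 0

/-- **The composite `Ψ Φ` on telescope points** is `compData … 0`. [folklore] -/
theorem hmap_hmap_emb (D : HomotopyData P f f') (k : ℕ) {x : E} (hx : x ∈ P) {s : ℝ}
    (hs : s ∈ Icc (0 : ℝ) 1) :
    hmap f D.reverse.H (hmap f' D.H (emb f k x s)) = compData f D.H 0 k x s := by
  rw [hmap_emb D k hx hs, hmapData, compData]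
  by_cases h4 : s ≤ 1 / 4
  · rw [if_pos (by linarith), if_pos h4,
      hmap_emb D.reverse k hx ⟨by linarith [hs.1], by linarith⟩, hmapData, if_pos (by linarith)]
    congr 1
    ring
  · rw [if_neg h4]
    by_cases h2 : s ≤ 1 / 2
    · rw [if_pos h2, hmap_emb D.reverse k hx ⟨by linarith [hs.1], by linarith⟩, hmapData,
        if_neg (by linarith), vee, if_pos h2, max_eq_left (by linarith)]
      simp only [HomotopyData.reverse_H]
      congr 2
      ring
    · rw [if_neg h2, hmap_emb D.reverse (k + 1) (D.H_mem x hx _ ⟨by linarith, by linarith [hs.2]⟩)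
        ⟨le_rfl, zero_le_one⟩, hmapData, if_pos (by norm_num), vee, if_neg h2,
        max_eq_left (by linarith)]
      norm_num

/-- Compatibility of `compData` with the identification. [folklore] -/
theorem compData_compat (D : HomotopyData P f f') {u : ℝ} (hu : u ≤ 1) (k : ℕ) (x : E) :
    compData f D.H u k x 1 = compData f D.H u (k + 1) (f x) 0 := by
  have h1 : ¬ ((1 : ℝ) ≤ 1 / 4) := by norm_num
  have h2 : ¬ ((1 : ℝ) ≤ 1 / 2) := by norm_num
  have h3 : (0 : ℝ) ≤ 1 / 4 := by norm_num
  simp only [compData, vee, if_neg h1, if_neg h2, if_pos h3]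
  norm_num [max_eq_left hu, D.H_one]

/-- `compData` is continuous in `((x, s), u)` on `(P × [0, 1]) × [0, 1]`. [folklore] -/
theorem continuousOn_compData (hf : ContinuousOn f P) (D : HomotopyData P f f') (k : ℕ) :
    ContinuousOn (fun q : (E × ℝ) × I => compData f D.H q.2 k q.1.1 q.1.2)
      ((P ×ˢ Icc 0 1) ×ˢ univ) := by
  refine continuousOn_if_le (continuous_snd.comp continuous_fst) (1 / 4) ?_ ?_ ?_
  · exact (continuousOn_emb hf k).comp (continuousOn_fst.fst.prodMk
      (continuousOn_const.mul continuousOn_fst.snd)) fun q hq => ⟨hq.1.1.1, mem_univ _⟩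
  · have hmax : Continuous fun q : (E × ℝ) × I => max (vee q.1.2) (q.2 : ℝ) := by
      have := continuous_vee
      fun_prop
    refine (continuousOn_emb hf (k + 1)).comp (ContinuousOn.prodMk ?_ continuousOn_const)
      fun q hq => ⟨D.H_mem _ hq.1.1.1 _ ?_, mem_univ _⟩
    · refine D.continuousOn_comp continuousOn_fst.fst hmax.continuousOn fun q hq =>
        ⟨hq.1.1.1, ?_⟩
      have hv := vee_mem ⟨hq.2, hq.1.1.2.2⟩
      exact ⟨le_max_of_le_left hv.1, max_le hv.2 q.2.2.2⟩
    · have hv := vee_mem ⟨hq.2, hq.1.1.2.2⟩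
      exact ⟨le_max_of_le_left hv.1, max_le hv.2 q.2.2.2⟩
  · rintro ⟨⟨x, s⟩, u⟩ - (h : s = 1 / 4)
    subst h
    have hv : vee (1 / 4) = 1 := by norm_num [vee]
    rw [hv, max_eq_left u.2.2, D.H_one]
    norm_num [emb_one]

/-- The contracting homotopy as a function on the ambient space. [folklore] -/
def compFun (f : E → E) (H : E → ℝ → E) (q : (E × E × ℝ) × I) : E × E × ℝ :=
  lift (compData f H q.2) q.1

/-- The contracting homotopy on telescope points. [folklore] -/
theorem compFun_emb (D : HomotopyData P f f') (k : ℕ) {x : E} (hx : x ∈ P) {s : ℝ}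
    (hs : s ∈ Icc (0 : ℝ) 1) (u : I) :
    compFun f D.H (emb f k x s, u) = compData f D.H u k x s :=
  lift_emb (P := P) (fun k x _ => compData_compat D u.2.2 k x) k hx hs

/-- The contracting homotopy is continuous on `telescope × [0, 1]`. [folklore] -/
theorem continuousOn_compFun (hP : IsCompact P) (hf : ContinuousOn f P)
    (D : HomotopyData P f f') : ContinuousOn (compFun f D.H) (space f P ×ˢ univ) :=
  continuousOn_prod_of_comp_emb hP hf fun k =>
    (continuousOn_compData hf D k).congr fun q hq => compFun_emb D k hq.1.1 hq.1.2 q.2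

/-- The contracting homotopy stays in the telescope. [folklore] -/
theorem compFun_mem (D : HomotopyData P f f') {p : E × E × ℝ} (hp : p ∈ space f P) (u : I) :
    compFun f D.H (p, u) ∈ space f P := by
  obtain ⟨k, x, s, hx, hs, rfl⟩ := exists_rep D.mapsTo_left hp
  rw [compFun_emb D k hx (Ico_subset_Icc_self hs) u, compData]
  split_ifs with h
  · exact emb_mem_space k hx ⟨by linarith [hs.1], by linarith⟩
  · have hv := vee_mem ⟨(not_le.1 h).le, hs.2.le⟩
    exact emb_mem_space (k + 1)
      (D.H_mem x hx _ ⟨le_max_of_le_left hv.1, max_le hv.2 u.2.2⟩) ⟨le_rfl, zero_le_one⟩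

/-- Levelwise data of the final reparametrisation: `(x, k + ((1 - u) min (4s) 1 + u s))`.
[folklore] -/
def repData (f : E → E) (u : ℝ) (k : ℕ) (x : E) (s : ℝ) : E × E × ℝ :=
  emb f k x ((1 - u) * min (4 * s) 1 + u * s)

/-- Compatibility of `repData`. [folklore] -/
theorem repData_compat (f : E → E) (u : ℝ) (k : ℕ) (x : E) :
    repData f u k x 1 = repData f u (k + 1) (f x) 0 := by
  unfold repData
  norm_num [emb_one]

/-- The reparametrisation homotopy as a function on the ambient space. [folklore] -/
def repFun (f : E → E) (q : (E × E × ℝ) × I) : E × E × ℝ := lift (repData f q.2) q.1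

/-- The reparametrisation on telescope points. [folklore] -/
theorem repFun_emb (f : E → E) (k : ℕ) {x : E} (hx : x ∈ P) {s : ℝ} (hs : s ∈ Icc (0 : ℝ) 1)
    (u : I) : repFun f (emb f k x s, u) = repData f u k x s :=
  lift_emb (P := P) (fun k x _ => repData_compat f u k x) k hx hs

/-- The parameter of `repData` stays in `[0, 1]`. [folklore] -/
theorem rep_param_mem {u s : ℝ} (hu : u ∈ Icc (0 : ℝ) 1) (hs : s ∈ Icc (0 : ℝ) 1) :
    (1 - u) * min (4 * s) 1 + u * s ∈ Icc (0 : ℝ) 1 := by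
  have h1 : 0 ≤ min (4 * s) 1 := le_min (by linarith [hs.1]) zero_le_one
  have h2 : min (4 * s) 1 ≤ 1 := min_le_right _ _
  constructor
  · nlinarith [hu.1, hu.2, hs.1]
  · nlinarith [hu.1, hu.2, hs.2]

/-- The reparametrisation homotopy is continuous on `telescope × [0, 1]`. [folklore] -/
theorem continuousOn_repFun (hP : IsCompact P) (hf : ContinuousOn f P) :
    ContinuousOn (repFun f) (space f P ×ˢ univ) := by
  refine continuousOn_prod_of_comp_emb hP hf fun k => ?_
  refine ContinuousOn.congr ?_ fun q hq => repFun_emb (P := P) f k hq.1.1 hq.1.2 q.2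
  unfold repData
  refine (continuousOn_emb hf k).comp (continuousOn_fst.fst.prodMk ?_)
    fun q hq => ⟨hq.1.1, mem_univ _⟩
  exact (by fun_prop : Continuous fun q : (E × ℝ) × I =>
    (1 - (q.2 : ℝ)) * min (4 * q.1.2) 1 + (q.2 : ℝ) * q.1.2).continuousOn

/-- The reparametrisation homotopy stays in the telescope. [folklore] -/
theorem repFun_mem {f : E → E} (hfP : MapsTo f P P) {p : E × E × ℝ} (hp : p ∈ space f P)
    (u : I) : repFun f (p, u) ∈ space f P := by
  obtain ⟨k, x, s, hx, hs, rfl⟩ := exists_rep hfP hp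
  rw [repFun_emb (P := P) f k hx (Ico_subset_Icc_self hs) u, repData]
  exact emb_mem_space k hx (rep_param_mem ⟨u.2.1, u.2.2⟩ (Ico_subset_Icc_self hs))

/-- The intermediate map `(x, k + s) ↦ (x, k + min (4s) 1)`. [folklore] -/
def midMap (hP : IsCompact P) (hf : ContinuousOn f P) (hfP : MapsTo f P P) :
    C(space f P, space f P) :=
  mapOfAmbient (fun p => repFun f (p, 0))
    ((continuousOn_repFun hP hf).comp (continuousOn_id.prodMk continuousOn_const)
      fun _ hp => ⟨hp, mem_univ _⟩)
    fun _ hp => repFun_mem hfP hp 0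

/-- **`Ψ Φ ≃ 𝟙`**: the composite of the maps of telescopes induced by `H` and by `H` reversed is
homotopic to the identity of `T(f)` (Hatcher 2002, p. 528, fact (1)). [cite: HatcherAT2002, Appendix p. 528 (telescope fact (1))] -/
theorem hmapMap_reverse_comp_homotopic (hP : IsCompact P) (hf : ContinuousOn f P)
    (hf' : ContinuousOn f' P) (D : HomotopyData P f f') :
    ((hmapMap hP hf' hf D.reverse).comp (hmapMap hP hf hf' D)).Homotopic
      (ContinuousMap.id (space f P)) := by
  have hfP := D.mapsTo_left
  -- first homotopy: contract the excursion, from `Ψ Φ` to `midMap`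
  have A : ContinuousMap.Homotopy ((hmapMap hP hf' hf D.reverse).comp (hmapMap hP hf hf' D))
      (midMap hP hf hfP) := by
    refine homotopyOfAmbient _ _ (compFun f D.H) (continuousOn_compFun hP hf D)
      (fun _ hp u => compFun_mem D hp u) (fun p => ?_) fun p => ?_
    · obtain ⟨k, x, s, hx, hs, hpe⟩ := exists_rep hfP p.2
      show compFun f D.H (p, 0) = hmap f D.reverse.H (hmap f' D.H p)
      rw [hpe, compFun_emb D k hx (Ico_subset_Icc_self hs), hmap_hmap_emb D k hx
        (Ico_subset_Icc_self hs)]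
      rfl
    · obtain ⟨k, x, s, hx, hs, hpe⟩ := exists_rep hfP p.2
      show compFun f D.H (p, 1) = repFun f (p, 0)
      rw [hpe, compFun_emb D k hx (Ico_subset_Icc_self hs),
        repFun_emb (P := P) f k hx (Ico_subset_Icc_self hs), compData, repData]
      simp only [Icc.coe_one, Icc.coe_zero, sub_zero, one_mul, zero_mul, add_zero]
      split_ifs with h
      · rw [min_eq_left (by linarith)]
      · have hv := vee_mem ⟨(not_le.1 h).le, hs.2.le⟩
        rw [max_eq_right hv.2, D.H_one, min_eq_right (by linarith), emb_one]
  -- second homotopy: undo the reparametrisation, from `midMap` to the identity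
  have B : ContinuousMap.Homotopy (midMap hP hf hfP) (ContinuousMap.id _) := by
    refine homotopyOfAmbient _ _ (repFun f) (continuousOn_repFun hP hf)
      (fun _ hp u => repFun_mem hfP hp u) (fun _ => rfl) fun p => ?_
    obtain ⟨k, x, s, hx, hs, hpe⟩ := exists_rep hfP p.2
    show repFun f (p, 1) = p
    rw [hpe, repFun_emb (P := P) f k hx (Ico_subset_Icc_self hs), repData]
    norm_num
  exact ⟨A.trans B⟩

/-- **Homotopic self-maps have homotopy equivalent telescopes** (Hatcher 2002, proof of
Prop. A.11, fact (1), p. 528): for a homotopy `H` in the compact set `P` from `f'` to `f` (both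
continuous on `P`), `T(f) ≃ T(f')` by the induced maps `Φ` (from `H`) and `Ψ` (from `H`
reversed). [cite: HatcherAT2002, Prop. A.11 (proof, fact (1))] -/
def homotopyEquivOfHomotopy (hP : IsCompact P) (hf : ContinuousOn f P) (hf' : ContinuousOn f' P)
    (D : HomotopyData P f f') : ContinuousMap.HomotopyEquiv (space f P) (space f' P) where
  toFun := hmapMap hP hf hf' D
  invFun := hmapMap hP hf' hf D.reverse
  left_inv := hmapMap_reverse_comp_homotopic hP hf hf' D
  right_inv := by
    have h := hmapMap_reverse_comp_homotopic hP hf' hf D.reverse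
    rwa [hmapMap_reverse_reverse] at h

end Telescope

end Literature.AlgebraicTopology.Homotopy

end
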